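import Literature.MathematicalPhysics.QuantumFieldTheory.Balaban1983to89.B8Prop6DentedCubeMemberFlatScalarGammaRec
import Literature.MathematicalPhysics.QuantumFieldTheory.Balaban1983to89.B8Prop6DentedCubeMemberNormsFlatGammaRec
import Literature.MathematicalPhysics.QuantumFieldTheory.Balaban1983to89.B8Prop6DentedCubeMemberGaugedRec
import Literature.MathematicalPhysics.QuantumFieldTheory.Balaban1983to89.B8Prop6DentedCubeMemberGaugedRealGamma

/-!
# `Balaban1983to89.B8Prop6DentedCubeMemberGaugedRealGammaRec` — RECORD TWIN of `B8Prop6DentedCubeMemberGaugedRealGamma` ([Balaban1985RegularSpaces] Prop. 6 (1.135)–(1.138) p. 99 AS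
# `Node00.GaugedBoundB8DZ` at every dented RECORD member, from the flat four-line Prop.-3-frame γ socket, three REAL inequality families and Theorem 4's (1.59) clause at background 1)
# FOR THE SYMMETRISED CENTRED block averaging (0.4) of [Balaban1987RG1] — item R6 (g)-5 of the record crown (desk `R6-PLAN.md` §5)

statement-level skeleton of published theorems with citation tags; proofs where landed; nothing here is a claim about the Yang–Mills mass gap

T. Bałaban, *Spaces of regular gauge field configurations on a lattice and gauge fixing conditions*, Commun. Math. Phys. **99** (1985) 75–102
`[Balaban1985RegularSpaces]` ("[6]"): Prop. 6 (1.135)–(1.138) p. 99, Thm 4 p. 88, Prop. 3 p. 87, Prop. 5 pp. 93–94, (1.58)–(1.62) pp. 86–87, (1.31) p. 82, (1.130) p. 98;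
T. Bałaban, *Propagators for lattice gauge theories in a background field*, Commun. Math. Phys. **99** (1985) 389–434 `[Balaban1985BackgroundPropagators]` ("[4]"): Thms 3.1–3.3
pp. 397–399; T. Bałaban, *Renormalization group approach to lattice gauge field theories. I*, Commun. Math. Phys. **109** (1987) 249–301 `[Balaban1987RG1]` ("[I]"): (0.3)–(0.4)
pp. 252–253.  STATUS: published, refereed.

CITATION HEADER (lean-in-tree rule).  Cell `pub-ymgap`, «N05-REC» stage 2 (director-ym №254∕№255∕№288), item R6 (g)-5 — typed by the LEAD PEN dag-n05-e g39 (inventory `N05-REC-INVENTORY.md` §R6 row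
`B8Prop6DentedCubeMemberGaugedRealGamma`: A `gaugedBoundB8D_dentedMember_real_γ`).  WHAT IS REPRODUCED = ✓ the engine module (seat `pub-ymgap-dag-n05-e` g31∕g32) VERBATIM under the token
map, + §0: private `regimeZ_of_printed_smallness` (twin of `B8Prop6CubeMember.regime_of_printed_smallness` at `C0Z`) and `windows136Z_of_small` (twin of `B8Prop6CubeMemberNormsAt.windows136_of_small`
over g38's `B8Prop6DentedCubeMemberNormsGammaRec.prop3_windowsZ`: every window from «7dL²Mα₀ ≤ c₁», record forms).  THEOREM NAMES = the engine's (namespace `…GaugedRealGammaRec`).  TOKEN MAP as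
in (g)-4 (`CubeB8D ↦ CubeB8DZ`, `GaugedBoundB8D ↦ Node00.GaugedBoundB8DZ`, `…Z` objects, `Real123Block L (flmZ L)` REAL premise, record (1.61) constant `hC₂ : 2·((1+2g_Z)(2·131072(d+1)²KZ²))·L² ≤ C₂`,
`h4C` with `KZ²`, `hc3α` with `KZ`).  Record inputs: (g)-4 `B8Prop6DentedCubeMemberFlatScalarGammaRec.prop6_dentedMember_flat_of_real_γ`, g38's (g)-3
`B8Prop6DentedCubeMemberNormsFlatGammaRec.norms136_dentedMember_flat_γ_d4`, (g)-1 `B8Prop6DentedCubeMemberGaugedRec.gaugedBoundB8D_of_clauses`, (g)-2 `…NormsGammaRec.prop3_windowsZ`;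
structure-free `B8Prop6OfThm4.const_136 ∕ smallness_134`, `B8Prop6CubeMemberNormsAt.ineq161_of_small`, `B8.prop6_smallness_iff`.  Kind «kernel-checked proof», theorems only; no `def`,
no `instance`, no `notation`, no existing module modified.  `--supports stmt-QuantumFields-20541` (K0⁷-keyed, COUNT-NEUTRAL).

HONEST SCOPE: the engine's proof verbatim under the token map; nothing of Bałaban's analysis newly proved; the four-line flat socket, the REAL families and `H59D₁` stay displayed (discharged
downstream by g38's unconditional Z facts); `HThm4Rec` UNDISCHARGED; caveat (C-S3-1) + addendum v4 stand; N05 [B8] DISCHARGED OF RECORD untouched; N05 ∕ N07 NOT discharged; COUNT of record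
unmoved · K numerically unchanged; one finite `𝕋⁴` programme at fixed `ε`, Bałaban AS PRINTED; nothing continuum ∕ ℝ⁴ ∕ OS ∕ mass-gap ∕ Clay.  No `sorry`, no `def`.

[cite: Balaban1985RegularSpaces, Prop. 6 (1.135)–(1.138) p.99, Theorem 4 p.88, Prop. 3 p.87, Prop. 5 pp.93–94, (1.58)–(1.62) pp.86–87, (1.31) p.82, (1.130) p.98;
Balaban1985BackgroundPropagators, Theorems 3.1–3.3 pp.397–399; Balaban1987RG1, (0.3)–(0.4) pp.252–253]
-/

noncomputable section

open NormedSpace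
open scoped BigOperators

namespace Literature.MathematicalPhysics.QuantumFieldTheory.Balaban1983to89.B8Prop6DentedCubeMemberGaugedRealGammaRec

open scoped Matrix
open MatrixLog B7Prop1Explicit B7Prop2Explicit B7Prop1Local B7Eq92Concrete
open B7Prop2Explicit (c2' c2'_pos)
open B7Prop2Rec (C0Z C0Z_pos)
open B7Prop3Flat (c3)
open B7Prop4GeneralLevelsRec (cZ gZ KZ gZ_nonneg)
open B7SectEFLinearisationRec (linCovIterZ)
open B8Ineq132 (covDerivFwd InAk BondTouches)
open B8Ineq133Rec (cutFixedZ)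
open B8Eq115GaugeFixingRec (localGaugeZ)
open B8Lemma1NonAbelian (mulCfg)
open B8Eq119TwistedAxialRec (Restr129Z flmZ)
open B8Eq140Level (SideTouches)
open B8Eq143PlaqExpansion (pdiv)
open B8Eq146AExpansion (iEta plaqCovDeriv)
open B8Eq155JBound (Jcur wsup)
open B8ScaledSupNorm (bondNorm msup)
open B8Eq184Proof (cfgExp)
open B8Eq138LandauZd (covLap logCfg)
open B8Eq138LandauZdRec (IsLandau138WZ)
open B8LambdaSpaceKLevel (wt)
open B8Eq131Cubes (tLo tHi ctr)
open B8Ineq130Rec (tlo thi)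
open B8Prop6OfThm4 (const_136 smallness_134)
open B8Prop6CubeMemberNorms (ineq161_of_small)
open B8Prop6DentedCubeMemberNormsGammaRec (prop3_windowsZ)
open B8Prop6DentedCubeMemberNormsFlatGammaRec (norms136_dentedMember_flat_γ_d4)
open B8Prop6DentedCubeMemberFlatScalarGammaRec (prop6_dentedMember_flat_of_real_γ)
open B9SupplySockB9P3ZdBeta (CrossB)
open B8Prop6DentedCubeMemberGaugedRec (gaugedBoundB8D_of_clauses)
open Node00 (CubeB8DZ GaugedBoundB8DZ)
open B8Real123FlatTranslateRec (Real123Block)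

export B7Prop1Explicit (Site)

variable {d : ℕ}

variable {𝔸 : Type} [CStarAlgebra 𝔸] [Nontrivial 𝔸]

/-! ## §0 The record windows from «7dL²Mα₀ ≤ c₁» (twins of `B8Prop6CubeMember.regime_of_printed_smallness` (private, `C0Z`) and `B8Prop6CubeMemberNormsAt.windows136_of_small`) -/

/-- **The regime conditions of (1.130) FROM PRINT'S SMALLNESS** (bookkeeping): if `7dL²Mα₀ ≤ c₁` with `c₁ ≤ 7∕(3C0(d))`, `c₁ ≤ 7c₂′(d, L)∕2`,
`c₁ ≤ 7∕36`, and `1 ≤ M`, `ρ ≤ M`, `11d < M`, `1 ≤ d`, then `C0·(α₀L²) ≤ 1∕3`, `2(α₀L²) ≤ c₂′` and `11d²L²α₀ + (M + 4ρ)dL²α₀ ≤ 1∕6` (the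
hypotheses `hα3`∕`hα2`∕`hsmall` of `B8Eq131Cubes.ineq132_cubes`). [cite: Balaban1985RegularSpaces, (1.130) p.98, Prop. 6 p.99 («let 7dL²Mα₀ ≤ c₁»)] -/
private theorem regimeZ_of_printed_smallness {L M ρ : ℕ} (hd : 1 ≤ d) (hM1 : 1 ≤ M) (hρM : ρ ≤ M) (hM : 11 * (d : ℝ) < M)
    {α₀ c₁ : ℝ} (hα : 0 < α₀) (hc : 7 * d * (L : ℝ) ^ 2 * M * α₀ ≤ c₁) (hc1 : c₁ ≤ 7 / (3 * C0Z d))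
    (hc2 : c₁ ≤ 7 * c2' d L / 2) (hc3 : c₁ ≤ 7 / 36) :
    C0Z d * (α₀ * (L : ℝ) ^ 2) ≤ 1 / 3 ∧ 2 * (α₀ * (L : ℝ) ^ 2) ≤ c2' d L ∧
      11 * (d : ℝ) ^ 2 * (L : ℝ) ^ 2 * α₀ + ((M : ℝ) + 4 * ρ) * d * (L : ℝ) ^ 2 * α₀ ≤ 1 / 6 := by
  have hd' : (1 : ℝ) ≤ d := by exact_mod_cast hd
  have hM' : (1 : ℝ) ≤ M := by exact_mod_cast hM1
  have hρM' : (ρ : ℝ) ≤ M := by exact_mod_cast hρM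
  have hC0 := C0Z_pos d
  have hx0 : 0 ≤ α₀ * (L : ℝ) ^ 2 := by positivity
  have hT0 : 0 ≤ (d : ℝ) * ((L : ℝ) ^ 2 * α₀) := by positivity
  -- the unit `t := dL²Mα₀ = (7dL²Mα₀)/7 ≤ c₁/7`
  have ht : (d : ℝ) * (L : ℝ) ^ 2 * M * α₀ ≤ c₁ / 7 := by linarith
  -- `α₀L² ≤ dML²α₀` since `dM ≥ 1`
  have hx : α₀ * (L : ℝ) ^ 2 ≤ c₁ / 7 := by
    have hdM : (1 : ℝ) ≤ (d : ℝ) * M := by nlinarith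
    have h1 : 1 * (α₀ * (L : ℝ) ^ 2) ≤ ((d : ℝ) * M) * (α₀ * (L : ℝ) ^ 2) := mul_le_mul_of_nonneg_right hdM hx0
    have h2 : ((d : ℝ) * M) * (α₀ * (L : ℝ) ^ 2) = (d : ℝ) * (L : ℝ) ^ 2 * M * α₀ := by ring
    linarith
  refine ⟨?_, by linarith, ?_⟩
  · calc C0Z d * (α₀ * (L : ℝ) ^ 2) ≤ C0Z d * (c₁ / 7) := mul_le_mul_of_nonneg_left hx hC0.le
      _ ≤ C0Z d * (7 / (3 * C0Z d) / 7) := by gcongr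
      _ = 1 / 3 := by field_simp
  · -- `11d²L²α₀ ≤ dML²α₀` from `11d < M`; `(M + 4ρ)dL²α₀ ≤ 5·dML²α₀` from `ρ ≤ M`
    have h11 : 11 * (d : ℝ) ^ 2 * (L : ℝ) ^ 2 * α₀ ≤ (d : ℝ) * (L : ℝ) ^ 2 * M * α₀ := by
      have h' : (11 * (d : ℝ)) * ((d : ℝ) * ((L : ℝ) ^ 2 * α₀)) ≤ (M : ℝ) * ((d : ℝ) * ((L : ℝ) ^ 2 * α₀)) :=
        mul_le_mul_of_nonneg_right hM.le hT0
      have e1 : 11 * (d : ℝ) ^ 2 * (L : ℝ) ^ 2 * α₀ = (11 * (d : ℝ)) * ((d : ℝ) * ((L : ℝ) ^ 2 * α₀)) := by ring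
      have e2 : (d : ℝ) * (L : ℝ) ^ 2 * M * α₀ = (M : ℝ) * ((d : ℝ) * ((L : ℝ) ^ 2 * α₀)) := by ring
      rw [e1, e2]; exact h'
    have h5 : ((M : ℝ) + 4 * ρ) * d * (L : ℝ) ^ 2 * α₀ ≤ 5 * ((d : ℝ) * (L : ℝ) ^ 2 * M * α₀) := by
      have h54 : ((M : ℝ) + 4 * ρ) ≤ 5 * M := by linarith
      have h' : ((M : ℝ) + 4 * ρ) * ((d : ℝ) * ((L : ℝ) ^ 2 * α₀)) ≤ (5 * M) * ((d : ℝ) * ((L : ℝ) ^ 2 * α₀)) :=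
        mul_le_mul_of_nonneg_right h54 hT0
      have e1 : ((M : ℝ) + 4 * ρ) * d * (L : ℝ) ^ 2 * α₀ = ((M : ℝ) + 4 * ρ) * ((d : ℝ) * ((L : ℝ) ^ 2 * α₀)) := by ring
      have e2 : 5 * ((d : ℝ) * (L : ℝ) ^ 2 * M * α₀) = (5 * M) * ((d : ℝ) * ((L : ℝ) ^ 2 * α₀)) := by ring
      rw [e1, e2]; exact h'
    linarith

/-- **EVERY WINDOW FROM ONE THRESHOLD** (bookkeeping for «α₀, α₁, α₂ bounded by a constant depending on d and L only», p. 87, and «let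
7dL²Mα₀ ≤ c₁», p. 99): for `d, L ≥ 2`, `B₀ > 0`, `C₂ ≥ 0` and a Proposition-3 threshold `c > 0` there is `c₁(d, L, B₀, C₂, c) > 0` such that
`7dL²Mα₀ ≤ c₁` and `L ≤ dM` give, with `(α₀′, α₁′) = (L³α₀, 6dL²Mα₀)`, `t = α₀′ + α₁′`, `α₂ = 5dLB₀·t`: the (1.130)-regime
(`B8Prop6CubeMember.regime_of_printed_smallness`), `α₀′, α₁′, α₂ ≤ c`, (1.61) (`ineq161_of_small`), the [3]-Prop.-4 ∕ Prop.-3 windows at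
`(α₀′, α₂)` (`B8LeafModelZd3.prop3_windows`), `dLα₁′ ≤ 1∕8` and `dMα₀ ≤ 1∕2`. [cite: Balaban1985RegularSpaces, Prop. 3 p.87, (1.61) p.86, Prop. 6 p.99, (1.130) p.98] -/
theorem windows136Z_of_small (hd2 : 2 ≤ d) {L : ℕ} (hL : 2 ≤ L) {B₀ C₂ c : ℝ} (hB₀ : 0 < B₀) (hC₂ : 0 ≤ C₂) (hc : 0 < c) :
    ∃ c₁ : ℝ, 0 < c₁ ∧ ∀ (M ρ : ℕ), 1 ≤ M → ρ ≤ M → 11 * (d : ℝ) < M → (L : ℝ) ≤ d * M → ∀ (α₀ : ℝ), 0 < α₀ →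
      7 * d * (L : ℝ) ^ 2 * M * α₀ ≤ c₁ →
      (C0Z d * (α₀ * (L : ℝ) ^ 2) ≤ 1 / 3 ∧ 2 * (α₀ * (L : ℝ) ^ 2) ≤ c2' d L ∧
        11 * (d : ℝ) ^ 2 * (L : ℝ) ^ 2 * α₀ + ((M : ℝ) + 4 * ρ) * d * (L : ℝ) ^ 2 * α₀ ≤ 1 / 6) ∧
      ((L : ℝ) ^ 3 * α₀ ≤ c ∧ 6 * d * (L : ℝ) ^ 2 * M * α₀ ≤ c ∧
        5 * (d : ℝ) * L * B₀ * ((L : ℝ) ^ 3 * α₀ + 6 * d * (L : ℝ) ^ 2 * M * α₀) ≤ c) ∧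
      2 * (5 * (d : ℝ) * L * B₀ * ((L : ℝ) ^ 3 * α₀ + 6 * d * (L : ℝ) ^ 2 * M * α₀)) ^ 2
        + 20 * d * ((L : ℝ) ^ 3 * α₀) * (5 * (d : ℝ) * L * B₀ * ((L : ℝ) ^ 3 * α₀ + 6 * d * (L : ℝ) ^ 2 * M * α₀))
        + 2 * C₂ * (5 * (d : ℝ) * L * B₀ * ((L : ℝ) ^ 3 * α₀ + 6 * d * (L : ℝ) ^ 2 * M * α₀)) ^ 2
        ≤ (L : ℝ) ^ 3 * α₀ + 6 * d * (L : ℝ) ^ 2 * M * α₀ ∧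
      (C0Z d * ((L : ℝ) ^ 3 * α₀) ≤ 1 / 3 ∧ 4 * ((L : ℝ) ^ 3 * α₀) ≤ c2' d L ∧
        16 * (5 * (d : ℝ) * L * B₀ * ((L : ℝ) ^ 3 * α₀ + 6 * d * (L : ℝ) ^ 2 * M * α₀)) ≤ 1 ∧
        Real.exp (4 * cZ d * ((L : ℝ) ^ 3 * α₀))
          * (1 + 2 * (131072 * ((d : ℝ) + 1) ^ 2) * (KZ d L) ^ 2 * (5 * (d : ℝ) * L * B₀ * ((L : ℝ) ^ 3 * α₀ + 6 * d * (L : ℝ) ^ 2 * M * α₀))) ≤ 2 ∧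
        KZ d L * (5 * (d : ℝ) * L * B₀ * ((L : ℝ) ^ 3 * α₀ + 6 * d * (L : ℝ) ^ 2 * M * α₀)) ≤ c3 d L ∧
        (d : ℝ) * L * (6 * d * (L : ℝ) ^ 2 * M * α₀) ≤ 1 / 8) ∧
      (d : ℝ) * M * α₀ ≤ 1 / 2 := by
  have hL1 : 1 ≤ L := le_trans (by norm_num) hL
  have hd1 : 1 ≤ d := le_trans (by norm_num) hd2
  have hLpos : (0 : ℝ) < L := by exact_mod_cast hL1
  have hL2 : (2 : ℝ) ≤ L := by exact_mod_cast hL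
  have hdpos : (0 : ℝ) < d := by exact_mod_cast hd1
  have hC0 := C0Z_pos d
  have hc2 := c2'_pos d L hL1
  obtain ⟨cw, hcw, hwin⟩ := prop3_windowsZ (d := d) hd1 hL1 hB₀.le
  set B : ℝ := 5 * (d : ℝ) * L * B₀ with hB
  have hBpos : 0 < B := by positivity
  set K : ℝ := (2 + 2 * C₂) * B ^ 2 + 20 * d * B with hK
  have hKpos : 0 < K := by positivity
  refine ⟨min c (min (c / B) (min cw (min (cw / B) (min (1 / K) (min (1 / (8 * d * L)) (min 14
    (min (7 / (3 * C0Z d)) (min (7 * c2' d L / 2) (7 / 36))))))))), ?_, ?_⟩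
  · exact lt_min hc (lt_min (by positivity) (lt_min hcw (lt_min (by positivity) (lt_min (by positivity) (lt_min (by positivity)
      (lt_min (by norm_num) (lt_min (by positivity) (lt_min (by positivity) (by norm_num)))))))))
  intro M ρ hM1 hρM hM hLdM α₀ hα hs
  simp only [le_min_iff] at hs
  obtain ⟨hs_c, hs_cB, hs_w, hs_wB, hs_K, hs_8, hs_14, hs_r1, hs_r2, hs_r3⟩ := hs
  have hMpos : (0 : ℝ) < M := by exact_mod_cast lt_of_lt_of_le (by norm_num) hM1
  set s : ℝ := 7 * d * (L : ℝ) ^ 2 * M * α₀ with hs_def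
  set t : ℝ := (L : ℝ) ^ 3 * α₀ + 6 * d * (L : ℝ) ^ 2 * M * α₀ with ht_def
  have hα₀' : 0 < (L : ℝ) ^ 3 * α₀ := by positivity
  have hα₁' : 0 < 6 * d * (L : ℝ) ^ 2 * M * α₀ := by positivity
  have hts : t ≤ s := (B8.prop6_smallness_iff hLpos hα).2 hLdM
  have h0t : (L : ℝ) ^ 3 * α₀ ≤ t := by rw [ht_def]; linarith
  have h1t : 6 * d * (L : ℝ) ^ 2 * M * α₀ ≤ t := by rw [ht_def]; linarith
  have htpos : 0 < t := by positivity
  have hBt : B * t ≤ B * s := mul_le_mul_of_nonneg_left hts hBpos.le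
  have hBs_c : B * s ≤ c := by
    have := mul_le_mul_of_nonneg_left hs_cB hBpos.le
    rwa [mul_div_cancel₀ _ hBpos.ne'] at this
  have hBs_w : B * s ≤ cw := by
    have := mul_le_mul_of_nonneg_left hs_wB hBpos.le
    rwa [mul_div_cancel₀ _ hBpos.ne'] at this
  -- the (1.130)-regime
  have hreg := regimeZ_of_printed_smallness (L := L) hd1 hM1 hρM hM hα le_rfl hs_r1 hs_r2 hs_r3
  -- (1.61)
  have hKt : K * t ≤ 1 := by
    calc K * t ≤ K * s := mul_le_mul_of_nonneg_left hts hKpos.le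
      _ ≤ K * (1 / K) := mul_le_mul_of_nonneg_left hs_K hKpos.le
      _ = 1 := by field_simp
  have h61 := ineq161_of_small (C₂ := C₂) hdpos.le h0t htpos.le hBpos.le hKt
  -- the Prop.-3 / [3]-Prop.-4 windows at `(α₀′, α₂ = B·t)`
  obtain ⟨hα3', hα4', h16, -, hsm, hc₃, -, -, -⟩ :=
    hwin ((L : ℝ) ^ 3 * α₀) (B * t) hα₀' (h0t.trans (hts.trans hs_w)) (by positivity) (hBt.trans hBs_w)
  -- `dLα₁′ ≤ 1/8` and `dMα₀ ≤ 1/2`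
  have h8 : (d : ℝ) * L * (6 * d * (L : ℝ) ^ 2 * M * α₀) ≤ 1 / 8 := by
    have hdL : (0 : ℝ) < d * L := by positivity
    calc (d : ℝ) * L * (6 * d * (L : ℝ) ^ 2 * M * α₀) ≤ (d * L) * s := mul_le_mul_of_nonneg_left (h1t.trans hts) hdL.le
      _ ≤ (d * L) * (1 / (8 * d * L)) := mul_le_mul_of_nonneg_left hs_8 hdL.le
      _ = 1 / 8 := by field_simp
  have h12 : (d : ℝ) * M * α₀ ≤ 1 / 2 := by
    have hL4 : (2 : ℝ) ^ 2 ≤ (L : ℝ) ^ 2 := pow_le_pow_left₀ (by norm_num) hL2 2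
    have hdM0 : 0 ≤ 7 * ((d : ℝ) * M * α₀) := by positivity
    have h28 : 7 * ((d : ℝ) * M * α₀) * (2 : ℝ) ^ 2 ≤ 7 * ((d : ℝ) * M * α₀) * (L : ℝ) ^ 2 :=
      mul_le_mul_of_nonneg_left hL4 hdM0
    have e : 7 * ((d : ℝ) * M * α₀) * (L : ℝ) ^ 2 = s := by rw [hs_def]; ring
    rw [e] at h28
    linarith
  exact ⟨hreg, ⟨h0t.trans (hts.trans hs_c), h1t.trans (hts.trans hs_c), hBt.trans hBs_c⟩, h61,
    ⟨hα3', hα4', h16, hsm, hc₃, h8⟩, h12⟩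

/-! ## §1 `GaugedBoundB8` at every cube from the flat bodies in the repaired currency -/

open Classical in
/-- ★★ **PROPOSITION 6 (p. 99), (1.135)–(1.138) AS `Node00.GaugedBoundB8` AT EVERY DENTED CUBE ([15] (148)–(150)), FROM THE FLAT FOUR-LINE PROP.-3-FRAME γ SOCKET, THREE
REAL INEQUALITY FAMILIES AND THEOREM 4's (1.59) CLAUSE `H59Dβ₁` AT BACKGROUND `1`** — p531701's `gaugedBoundB8_cubeMember_real_bdry` with both (1.59) inputs in EDITION γ
(averaging datum `|B₁|` over the split print class `cubeLamBP'` ∪ {level-0 crossing bonds of `□₀`} (inner AND crossing bonds at every level); per cube the bodies of dag-n06-b's `SockB9P3D4β` at the flat data); the three REAL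
families VERBATIM; served by `B8Prop6CubeMemberNormsFlatGamma.norms136_cubeMember_flat_γ_d4` and `B8Prop6CubeMemberFlatScalarGamma.prop6_cubeMember_flat_of_real_γ`;
proof verbatim. [cite: Balaban1985RegularSpaces, Prop. 6 (1.135)–(1.138) p.99, Thm 4 p.88, Prop. 3 p.87, Prop. 5 pp.93–94, (1.58)–(1.59) p.86, (1.31) p.82; Balaban1985BackgroundPropagators, Thms 3.1–3.3 pp.397–399] -/
theorem gaugedBoundB8D_dentedMember_real_γ (hd2 : 2 ≤ d) {L sL : ℕ} (hLs : L = 2 * sL + 1) (hs1 : 1 ≤ sL) {B₀ B₀' C₂ cB9 B₀'H B₂' BG BR Bbd : ℝ} (hB₀ : 0 < B₀)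
    (hB₀' : 0 < B₀') (hB : 2 ≤ 5 * (d : ℝ) * L * B₀) (hC₂ : 2 * ((1 + 2 * gZ d L) * (2 * (131072 * ((d : ℝ) + 1) ^ 2) * (KZ d L) ^ 2)) * (L : ℝ) ^ 2 ≤ C₂) (hcB9 : 0 < cB9)
    (hB₀'H : 0 < B₀'H) (hB₂' : 0 ≤ B₂') (hBG : 0 ≤ BG) (hBR : 0 ≤ BR) (hfree : 3 * (2 * (d : ℝ) * (L : ℝ) ^ 2) * BG * BR ≤ B₀')
    (hBbd : 0 ≤ Bbd) (hBd : 4 * Bbd ≤ ((d : ℝ) * L - 1) * B₀) :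
    ∃ c₁ : ℝ, 0 < c₁ ∧ ∀ (η : ℝ), 0 < η → ∀ {K : ℕ} {Ω : ℕ → Set (Site d)} (c : CubeB8DZ d L K Ω),
      -- (1.59) for `G(1)`, `H(1)` IN THE REPAIRED CURRENCY: the FOUR-LINE Prop.-3-frame socket at background `1` on the cube, collar term on each line
      (∀ α₀' α₂ : ℝ, 0 < α₀' → α₀' ≤ cB9 → 0 < α₂ → α₂ ≤ cB9 →
        ∀ (W : Site d → Fin d → 𝔸ˣ), (∀ x κ, W x κ ∈ unitaryUnits 𝔸) →
        InAk L c.k η α₀' c.sq (1 : Site d → Fin d → 𝔸ˣ) → InAk L c.k η α₀' c.sq (mulCfg W (1 : Site d → Fin d → 𝔸ˣ)) →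
        IsLandau138WZ L c.k η (c.sq 0) c.lamS (1 : Site d → Fin d → 𝔸ˣ) W →
        ∀ A' : Site d → Fin d → 𝔸, (∀ y τ, IsSelfAdjoint (A' y τ)) →
        (∀ j, j ≤ c.k → ∀ (y : Site d) (τ : Fin d), SideTouches (c.sq j) y τ →
          W y τ = cfgExp η A' y τ ∧ ‖A' y τ‖ ≤ α₂ * ((L : ℝ) ^ j * η)⁻¹) →
        (∀ (y : Site d) (τ : Fin d), (∀ j, j ≤ c.k → ¬ SideTouches (c.sq j) y τ) → A' y τ = 0) →
        msup L c.k η (-(1 : ℝ)) (fun j (b : Site d × Fin d) => SideTouches (c.sq j) b.1 b.2) (fun b => A' b.1 b.2)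
            ≤ B₀ * (bondNorm L c.k η (-(3 : ℝ)) c.sq (fun x μ => Jcur η (1 : Site d → Fin d → 𝔸ˣ) A' μ x)
              + wsup 1 (fun p : {p : ℕ × (Site d × Fin d) // p.1 ≤ c.k ∧ (p.2 ∈ c.lamBPT c.k p.1 ∨ (p.1 = 0 ∧ CrossB (c.sq 0) p.2))} =>
                  linCovIterZ L (1 : Site d → Fin d → 𝔸ˣ) (iEta η A') p.1.1 p.1.2.1 p.1.2.2))
              + Bbd * msup L c.k η (-(1 : ℝ)) (fun j (b : Site d × Fin d) => j = 0 ∧ SideTouches (c.sq 0) b.1 b.2 ∧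
                  ¬ BondTouches (c.sq 0) b.1 b.2) (fun b => A' b.1 b.2) ∧
          msup L c.k η (-(2 : ℝ)) (fun j (t : Fin d × Fin d × Site d) => SideTouches (c.sq j) t.2.2 t.2.1)
              (fun t => covDerivFwd η (1 : Site d → Fin d → 𝔸ˣ) t.1 (fun z => A' z t.2.1) t.2.2)
            ≤ B₀ * (bondNorm L c.k η (-(3 : ℝ)) c.sq (fun x μ => Jcur η (1 : Site d → Fin d → 𝔸ˣ) A' μ x)
              + wsup 1 (fun p : {p : ℕ × (Site d × Fin d) // p.1 ≤ c.k ∧ (p.2 ∈ c.lamBPT c.k p.1 ∨ (p.1 = 0 ∧ CrossB (c.sq 0) p.2))} =>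
                  linCovIterZ L (1 : Site d → Fin d → 𝔸ˣ) (iEta η A') p.1.1 p.1.2.1 p.1.2.2))
              + Bbd * msup L c.k η (-(1 : ℝ)) (fun j (b : Site d × Fin d) => j = 0 ∧ SideTouches (c.sq 0) b.1 b.2 ∧
                  ¬ BondTouches (c.sq 0) b.1 b.2) (fun b => A' b.1 b.2) ∧
          bondNorm L c.k η (-(3 : ℝ)) c.sq (fun x μ => pdiv η (1 : Site d → Fin d → 𝔸ˣ) (plaqCovDeriv η (1 : Site d → Fin d → 𝔸ˣ) A') μ x)
            ≤ B₀ * (bondNorm L c.k η (-(3 : ℝ)) c.sq (fun x μ => Jcur η (1 : Site d → Fin d → 𝔸ˣ) A' μ x)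
              + wsup 1 (fun p : {p : ℕ × (Site d × Fin d) // p.1 ≤ c.k ∧ (p.2 ∈ c.lamBPT c.k p.1 ∨ (p.1 = 0 ∧ CrossB (c.sq 0) p.2))} =>
                  linCovIterZ L (1 : Site d → Fin d → 𝔸ˣ) (iEta η A') p.1.1 p.1.2.1 p.1.2.2))
              + Bbd * msup L c.k η (-(1 : ℝ)) (fun j (b : Site d × Fin d) => j = 0 ∧ SideTouches (c.sq 0) b.1 b.2 ∧
                  ¬ BondTouches (c.sq 0) b.1 b.2) (fun b => A' b.1 b.2) ∧
          bondNorm L c.k η (-(3 : ℝ)) c.sq (fun x μ => covLap η (1 : Site d → Fin d → 𝔸ˣ) (fun z => A' z μ) x)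
            ≤ B₀ * (bondNorm L c.k η (-(3 : ℝ)) c.sq (fun x μ => Jcur η (1 : Site d → Fin d → 𝔸ˣ) A' μ x)
              + wsup 1 (fun p : {p : ℕ × (Site d × Fin d) // p.1 ≤ c.k ∧ (p.2 ∈ c.lamBPT c.k p.1 ∨ (p.1 = 0 ∧ CrossB (c.sq 0) p.2))} =>
                  linCovIterZ L (1 : Site d → Fin d → 𝔸ˣ) (iEta η A') p.1.1 p.1.2.1 p.1.2.2))
              + Bbd * msup L c.k η (-(1 : ℝ)) (fun j (b : Site d × Fin d) => j = 0 ∧ SideTouches (c.sq 0) b.1 b.2 ∧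
                  ¬ BondTouches (c.sq 0) b.1 b.2) (fun b => A' b.1 b.2)) →
      ∀ (U₀ : Site d → Fin d → 𝔸ˣ), (∀ x κ, U₀ x κ ∈ unitaryUnits 𝔸) → ∀ (α₀ : ℝ), 0 < α₀ → InAk L K η α₀ Ω U₀ →
      7 * d * (L : ℝ) ^ 2 * c.M * α₀ ≤ c₁ →
      -- the weights of `Q′ᵀwQ′` and THE THREE REAL INEQUALITY FAMILIES at every truncation `n ≤ k`, CENTRED labels (`Real123Block`)
      ∀ (w : ℕ → ℝ), (∀ j, 0 ≤ w j) →
      (∀ n, 1 ≤ n → n ≤ c.k → Real123Block L (flmZ L) η n w c.sq (c.lamST n) BG B₀'H B₂' BR) →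
      -- (1.59) for `G(1)` IN THE REPAIRED CURRENCY: Theorem 4's two-member clause at background `1`, support clause + collar allowance (`H59D₁`)
      ((∀ m, 1 ≤ m → m ≤ c.k → ∀ (u : Site d → 𝔸ˣ) (W : Site d → Fin d → 𝔸ˣ) (A' : Site d → Fin d → 𝔸),
        (∀ x, u x ∈ unitaryUnits 𝔸) → (∀ x, x ∉ c.sq 0 → u x = 1) →
          mgauge (1 : Site d → Fin d → 𝔸ˣ) u W = (cutFixedZ L (tLo c.a c.ρ) (tHi c.a c.M c.ρ) U₀ c.k (ctr c.a c.M)) →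
          Restr129Z L m (c.lamST m) (1 : Site d → Fin d → 𝔸ˣ) u →
          IsLandau138WZ L m η (c.sq 0) (c.lamST m) (1 : Site d → Fin d → 𝔸ˣ) W →
        (∀ y τ, IsSelfAdjoint (A' y τ)) →
        (∀ j, j ≤ m → ∀ y τ, SideTouches (c.sq j) y τ →
        W y τ = cfgExp η A' y τ ∧
          ‖A' y τ‖ ≤ (2 * (L * (5 * (d : ℝ) * L * B₀ * (((L : ℝ) ^ 3 * α₀) + (6 * d * (L : ℝ) ^ 2 * c.M * α₀)))) + 8 * (8 * B₀' * (5 * (d : ℝ) * L * B₀) * (((L : ℝ) ^ 3 * α₀) + (6 * d * (L : ℝ) ^ 2 * c.M * α₀)))) * ((L : ℝ) ^ j * η)⁻¹) →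
        (∀ y τ, (∀ j, j ≤ m → ¬ SideTouches (c.sq j) y τ) → A' y τ = 0) →
        msup L m η (-(1 : ℝ)) (fun j (b : Site d × Fin d) => SideTouches (c.sq j) b.1 b.2) (fun b => A' b.1 b.2)
        ≤ B₀ * (bondNorm L m η (-(3 : ℝ)) c.sq (fun x μ => Jcur η (1 : Site d → Fin d → 𝔸ˣ) A' μ x)
        + wsup 1 (fun p : {p : ℕ × (Site d × Fin d) // p.1 ≤ m ∧ (p.2 ∈ c.lamBPT m p.1 ∨ (p.1 = 0 ∧ CrossB (c.sq 0) p.2))} =>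
        linCovIterZ L (1 : Site d → Fin d → 𝔸ˣ) (iEta η A') p.1.1 p.1.2.1 p.1.2.2))
        + Bbd * msup L m η (-(1 : ℝ)) (fun j (b : Site d × Fin d) => j = 0 ∧ SideTouches (c.sq 0) b.1 b.2 ∧
            ¬ BondTouches (c.sq 0) b.1 b.2) (fun b => A' b.1 b.2) ∧
        msup L m η (-(2 : ℝ)) (fun j (t : Fin d × Fin d × Site d) => SideTouches (c.sq j) t.2.2 t.2.1)
        (fun t => covDerivFwd η (1 : Site d → Fin d → 𝔸ˣ) t.1 (fun z => A' z t.2.1) t.2.2)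
        ≤ B₀ * (bondNorm L m η (-(3 : ℝ)) c.sq (fun x μ => Jcur η (1 : Site d → Fin d → 𝔸ˣ) A' μ x)
        + wsup 1 (fun p : {p : ℕ × (Site d × Fin d) // p.1 ≤ m ∧ (p.2 ∈ c.lamBPT m p.1 ∨ (p.1 = 0 ∧ CrossB (c.sq 0) p.2))} =>
        linCovIterZ L (1 : Site d → Fin d → 𝔸ˣ) (iEta η A') p.1.1 p.1.2.1 p.1.2.2))
        + Bbd * msup L m η (-(1 : ℝ)) (fun j (b : Site d × Fin d) => j = 0 ∧ SideTouches (c.sq 0) b.1 b.2 ∧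
            ¬ BondTouches (c.sq 0) b.1 b.2) (fun b => A' b.1 b.2))) →
      GaugedBoundB8DZ L η U₀ c (7 * d * (L : ℝ) ^ 2 * (5 * (d : ℝ) * L * B₀) * c.M * α₀) := by
  have hL1 : 1 ≤ L := by omega
  have hL : 2 ≤ L := by omega
  have hd1 : 1 ≤ d := le_trans (by norm_num) hd2
  have hLpos : (0 : ℝ) < L := by exact_mod_cast hL1
  have hdpos : (0 : ℝ) < d := by exact_mod_cast hd1
  have hgZ := gZ_nonneg d L
  have hC₂0 : 0 ≤ C₂ := le_trans (by positivity) hC₂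
  obtain ⟨c₄, hc₄, H4⟩ := prop6_dentedMember_flat_of_real_γ (𝔸 := 𝔸) hd2 hLs hs1 hB₀ hB₀' hB hB₀'H hB₂' hBG hBR hfree hBbd hBd
  obtain ⟨c₃, hc₃, N3⟩ := norms136_dentedMember_flat_γ_d4 (𝔸 := 𝔸) hd2 hLs hs1 hB₀ hC₂ hcB9 hBbd hBd
  obtain ⟨cW, hcW, W⟩ := windows136Z_of_small hd2 hL hB₀ hC₂0 hc₃
  set B : ℝ := 5 * (d : ℝ) * L * B₀ with hB_def
  have hB0 : 0 < B := by positivity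
  have hKZ2 : (2 : ℝ) ≤ KZ d L := by have h := gZ_nonneg d L; show (2 : ℝ) ≤ 2 * (1 + 2 * gZ d L); linarith only [h]
  have hKZ0 : 0 < KZ d L := by linarith only [hKZ2]
  set C : ℝ := 131072 * ((d : ℝ) + 1) ^ 2 * (KZ d L) ^ 2 with hC_def
  have hC0 : 0 < C := by positivity
  refine ⟨min c₄ (min cW (1 / (16 * C * B))), lt_min hc₄ (lt_min hcW (by positivity)), ?_⟩
  intro η hη K Ω c SB9 U₀ hU₀ α₀ hα hAK hs w hw REAL H59
  -- the cube's laws as datum binders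
  have hk : 1 ≤ c.k := c.one_le_k
  have hρL : L ≤ c.ρ := c.L_le_ρ
  have hρM : c.ρ ≤ c.M := c.ρ_le_M
  have hρ : 1 ≤ c.ρ := hL1.trans hρL
  have hM1 : 1 ≤ c.M := hρ.trans hρM
  have hM : 11 * (d : ℝ) < c.M := by exact_mod_cast c.big
  have hLdM : (L : ℝ) ≤ d * c.M := by exact_mod_cast c.L_le_dM
  have hA : InAk L c.k η α₀ Ω U₀ := c.inAk hAK
  have hs₄ : 7 * d * (L : ℝ) ^ 2 * c.M * α₀ ≤ c₄ := hs.trans (min_le_left _ _)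
  have hsW : 7 * d * (L : ℝ) ^ 2 * c.M * α₀ ≤ cW := hs.trans ((min_le_right _ _).trans (min_le_left _ _))
  have hsC : 7 * d * (L : ℝ) ^ 2 * c.M * α₀ ≤ 1 / (16 * C * B) := hs.trans ((min_le_right _ _).trans (min_le_right _ _))
  -- every window from «7dL²Mα₀ ≤ c₁»
  obtain ⟨⟨hα3, hα2, hsmall⟩, ⟨hα₀c, hα₁c, hα₂c⟩, h61, ⟨-, -, h16, -, hc3α, hsmall₁⟩, h12⟩ := W c.M c.ρ hM1 hρM hM hLdM α₀ hα hsW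
  -- PROPOSITION 6's existence half at the member FROM THE REAL FAMILIES + `H59D₁` (this seat's `B8Prop6CubeMemberFlatScalarBdry`)
  obtain ⟨u, hu, huS, h129, hLan, h162, hw', h135⟩ := H4 η hη c U₀ hU₀ α₀ hα hα3 hα2 hA
    hsmall (smallness_134 hLpos hα hLdM hs₄) w hw REAL H59
  -- PROPOSITION 3's norm members at the member FROM THE FOUR-LINE FLAT SOCKET (this seat's `B8Prop6CubeMemberNormsFlatBdry4`)
  obtain ⟨h136g, h139j, h139l⟩ := N3 η hη c SB9 U₀ hU₀ α₀ hα hα3 hα2 hA hsmall hα₀c hα₂c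
    h61 hsmall₁ u hu huS h129 hLan h162
  -- the three norm members of (1.136), with print's constant (`const_136`)
  have hconst : B * ((L : ℝ) ^ 3 * α₀ + 6 * d * (L : ℝ) ^ 2 * c.M * α₀) ≤ 7 * d * (L : ℝ) ^ 2 * B * c.M * α₀ :=
    const_136 hLpos hα hB0.le hLdM
  have h136₂ := h136g.trans hconst
  have h136₃ := h139j.trans hconst
  have h136₄ := h139l.trans hconst
  have h16C : 16 * (131072 * ((d : ℝ) + 1) ^ 2 * (KZ d L) ^ 2) * (B * ((L : ℝ) ^ 3 * α₀ + 6 * d * (L : ℝ) ^ 2 * c.M * α₀)) ≤ 1 := by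
    have e1 : B * ((L : ℝ) ^ 3 * α₀ + 6 * d * (L : ℝ) ^ 2 * c.M * α₀) ≤ 7 * d * (L : ℝ) ^ 2 * B * c.M * α₀ := hconst
    have e3 : B * (7 * d * (L : ℝ) ^ 2 * c.M * α₀) ≤ B * (1 / (16 * C * B)) := mul_le_mul_of_nonneg_left hsC hB0.le
    have e4 : B * (1 / (16 * C * B)) = 1 / (16 * C) := by field_simp
    have e2 : 7 * d * (L : ℝ) ^ 2 * B * c.M * α₀ = B * (7 * d * (L : ℝ) ^ 2 * c.M * α₀) := by ring
    have e5 : B * ((L : ℝ) ^ 3 * α₀ + 6 * d * (L : ℝ) ^ 2 * c.M * α₀) ≤ 1 / (16 * C) := by linarith [e1, e3]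
    calc 16 * (131072 * ((d : ℝ) + 1) ^ 2 * (KZ d L) ^ 2) * (B * ((L : ℝ) ^ 3 * α₀ + 6 * d * (L : ℝ) ^ 2 * c.M * α₀))
        ≤ 16 * C * (1 / (16 * C)) := mul_le_mul_of_nonneg_left e5 (by positivity)
      _ = 1 := by field_simp
  have h4C : 4 * (131072 * ((d : ℝ) + 1) ^ 2) * (KZ d L) ^ 2 * (5 * (d : ℝ) * L * B₀ * ((L : ℝ) ^ 3 * α₀ + 6 * d * (L : ℝ) ^ 2 * c.M * α₀)) ≤ 1 := by
    have h0 : 0 ≤ (131072 * ((d : ℝ) + 1) ^ 2 * (KZ d L) ^ 2) * (B * ((L : ℝ) ^ 3 * α₀ + 6 * d * (L : ℝ) ^ 2 * c.M * α₀)) := by positivity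
    have e : 4 * (131072 * ((d : ℝ) + 1) ^ 2) * (KZ d L) ^ 2 * (5 * (d : ℝ) * L * B₀ * ((L : ℝ) ^ 3 * α₀ + 6 * d * (L : ℝ) ^ 2 * c.M * α₀))
        = 4 * ((131072 * ((d : ℝ) + 1) ^ 2 * (KZ d L) ^ 2) * (B * ((L : ℝ) ^ 3 * α₀ + 6 * d * (L : ℝ) ^ 2 * c.M * α₀))) := by rw [hB_def]; ring
    rw [e]; linarith only [h16C, h0]
  exact gaugedBoundB8D_of_clauses hd2 hLs hs1 hB₀ hη c U₀ hU₀ hα hA hα3 hα2 hsmall h4C hc3α u hu huS h129 hLan h162 hw' h135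
    h136₂ h136₃ h136₄

end Literature.MathematicalPhysics.QuantumFieldTheory.Balaban1983to89.B8Prop6DentedCubeMemberGaugedRealGammaRec

end
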